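import Mathlib.RepresentationTheory.Homological.GroupCohomology.Functoriality
import Literature.AlgebraicGeometry.HodgeTheory.LocallyTrivialExtensionClasses

/-!
# Route LinearSystemTorelli — crux `LocalTubeSpan` (stmt-HodgeConjecture-2490): cyclic detection descends along an equivariant retraction

Helper file (`--supports stmt-HodgeConjecture-2490`, line `Sketch` of the crux chain, cycle 4
"portability of cyclic detection", stub `stub_retract`).  The line reduces the crux ("local
Schnell theorem", C. Schnell, *Primitive cohomology and the tube mapping*, Math. Z. 268 (2010) §3,
§7) to CYCLIC DETECTION: injectivity of Schnell's third map
`evalCoinv A : H¹(G, A) → ∏_{g ∈ G} A/(g - 1)A` for the local monodromy representation.  Cycle 4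
makes cyclic detection portable between coefficient rings (`ℚ`-spine versus the tree's `ℂ`-local
systems); this file is the easy half of the base change, detection DESCENDS:

* `localTubeSpan_injective_evalCoinv_of_retract` — let `A` be a `k`-representation and `A'` a
  `K`-representation of the same group `G` (any two commutative coefficient rings), `i : A → A'`
  an additive `G`-equivariant map and `P : A' → A` an additive `G`-equivariant retraction
  (`P ∘ i = id`; e.g. `A' = K ⊗_k A`, `P = r ⊗ id` for a `k`-linear retraction `r : K → k`, or
  `A` a stable direct summand of `A'`).  If the third map of `A'` is injective, so is the third
  map of `A`.

Proof: an undetected `1`-cocycle `φ` of `A` (`φ g ∈ (g - 1)A` for all `g`) pushes forward to the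
`1`-cocycle `i ∘ φ` of `A'`, again undetected (`i (g·y - y) = g·(i y) - i y`), hence a coboundary
`i (φ g) = g·x' - x'` by the hypothesis on `A'`; applying `P`,
`φ g = P (i (φ g)) = g·(P x') - P x'`, so `φ = d (P x')` is a coboundary.  Pure group cohomology
over Mathlib (`groupCohomology.H1`, `cocycles₁`, `H1π_eq_zero_iff`) and the tree's vocabulary
(`Literature.AlgebraicGeometry.HodgeTheory.LocallyTrivialExtensionClasses`: `evalCoinv`,
`subOneRange`, `evalCoinv_H1π`, `mem_coboundaries₁_iff_exists`); no named facts, no geometry.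
-/

-- `Summit.HodgeConjecture.HodgeConjecture.Theorems` is the mandated namespace (single-conjunct summit:
-- Sub = Summit), which `linter.dupNamespace` flags on every declaration; the lakefile turns the
-- linter off tree-wide (weak option), restated here so stand-alone elaboration is warning-free too.
set_option linter.dupNamespace false

noncomputable section

open CategoryTheory groupCohomology
open Literature.AlgebraicGeometry.HodgeTheory

namespace Summit.HodgeConjecture.HodgeConjecture.Theorems

universe u

/-- **Cyclic detection descends along an equivariant retraction.**  Let `A` be a
`k`-representation and `A'` a `K`-representation of the same group `G`, `i : A → A'` an additive
`G`-equivariant map with an additive `G`-equivariant retraction `P : A' → A` (`P ∘ i = id`).  If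
Schnell's third map `H¹(G, A') → ∏_g A'/(g - 1)A'` is injective then so is
`H¹(G, A) → ∏_g A/(g - 1)A`: an undetected cocycle `φ` of `A` pushes forward to the undetected
cocycle `i ∘ φ = d x'` of `A'`, and `φ = P ∘ i ∘ φ = d (P x')`. [folklore] -/
theorem localTubeSpan_injective_evalCoinv_of_retract {k K G : Type u} [Group G] [CommRing k]
    [CommRing K] (A : Rep k G) (A' : Rep K G)
    (i : A.V →+ A'.V) (hi : ∀ (g : G) (x : A.V), i (A.ρ g x) = A'.ρ g (i x))
    (P : A'.V →+ A.V) (hP : ∀ (g : G) (x' : A'.V), P (A'.ρ g x') = A.ρ g (P x'))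
    (hPi : ∀ x : A.V, P (i x) = x) (hinj : Function.Injective (evalCoinv A')) :
    Function.Injective (evalCoinv A) := by
  refine (injective_iff_map_eq_zero _).2 fun ξ hξ => ?_
  induction ξ using H1_induction_on with
  | h φ =>
    -- `φ` is undetected: every value `φ g` lies in `(g - 1)A`
    have hφ : ∀ g : G, (φ : G → A.V) g ∈ subOneRange A g := fun g => by
      have := congr_fun hξ g
      rwa [evalCoinv_H1π, Pi.zero_apply, Submodule.mkQ_apply, Submodule.Quotient.mk_eq_zero]
        at this
    -- the pushed-forward cochain `i ∘ φ` is a `1`-cocycle of `A'`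
    have hψmem : (fun g : G => i ((φ : G → A.V) g)) ∈ cocycles₁ A' := by
      rw [mem_cocycles₁_iff]
      intro g h
      rw [(mem_cocycles₁_iff φ).1 φ.2 g h, map_add, hi]
    set ψ : cocycles₁ A' := ⟨_, hψmem⟩
    -- `ψ` is undetected as well: `i (g·y - y) = g·(i y) - i y`
    have hψ0 : evalCoinv A' (H1π A' ψ) = 0 := by
      funext g
      rw [evalCoinv_H1π, Pi.zero_apply, Submodule.mkQ_apply, Submodule.Quotient.mk_eq_zero]
      obtain ⟨y, hy⟩ := hφ g
      refine ⟨i y, ?_⟩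
      rw [LinearMap.sub_apply, LinearMap.id_apply] at hy ⊢
      change A'.ρ g (i y) - i y = i ((φ : G → A.V) g)
      rw [← hy, map_sub, hi]
    -- hence a coboundary, by cyclic detection for `A'`
    have hzero : H1π A' ψ = 0 := (injective_iff_map_eq_zero _).1 hinj _ hψ0
    rw [H1π_eq_zero_iff, mem_coboundaries₁_iff_exists] at hzero
    obtain ⟨x', hx'⟩ := hzero
    -- apply the retraction: `φ g = P (i (φ g)) = P (g·x' - x') = g·(P x') - P x'`
    rw [H1π_eq_zero_iff, mem_coboundaries₁_iff_exists]
    refine ⟨P x', fun g => ?_⟩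
    have hg : P (ψ g) = (φ : G → A.V) g := hPi _
    rw [← hg, ← hx' g, map_sub, hP]

end Summit.HodgeConjecture.HodgeConjecture.Theorems

end
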